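import Summits.AtomisticToContinuum.BoseEinsteinCondensation.Theorems.BECProbeMassFlowCloudMomentumAtomForEachReduction
import HarnessLib

/-!
# Cross-route link: `CloudMomentumAtom` from the static-impurity rigidity of route `BECSwapNoCatastrophe`
# (crux `BECProbeMassFlow.CloudMomentumAtom`, item stmt-AtomisticToContinuum-12310, lead c4)

Helper file for the crux `BECProbeMassFlow.CloudMomentumAtom`, line `registered` (skeleton
`Cruxes/CloudMomentumAtom/Lines/birth.lean`). Two sorry-free implications, recorded so that the planner
can see that this crux is DOWNSTREAM of the "first rung" of the sibling route `BECSwapNoCatastrophe`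
(`Theses.BECSwapNoCatastrophe.TorusStaticImpurityRigidity`, item stmt-AtomisticToContinuum-14395: no
orthogonality catastrophe for a pinned scatterer in the dilute interacting torus gas, in integrated
Fubini–Study form along the coupling `t ∈ [0,1]`), once that statement is read at THIS route's box
convention (`N` bosons on the torus of side `sideLength ρ (N + 1)`; stmt-14395 uses `sideLength ρ N`, and
the two cannot be bridged by reparametrising `ρ`, because the eventual-`N` threshold is not uniform in
`ρ`) and over the whole admissible class (stmt-14395 carries a boundedness guard on `v`):

* `cloudMomentumAtom_of_endpointFidelity`: the "∀Φ ∀Ψ" endpoint fidelity (every pinned near-minimiser and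
  every free near-minimiser overlap `≥ 1 − ε`, slack chosen after `N`) implies the crux — through the
  landed one-stub composition `cloudMomentumAtom_of_fidelityForEach` (p156285) and the existence of free
  near-minimisers at every positive slack;
* `cloudMomentumAtom_of_staticImpurityRigiditySucc`: the body of `TorusStaticImpurityRigidity`, verbatim
  but at side `sideLength ρ (N + 1)` and without the boundedness guard, implies the endpoint fidelity
  (instantiate `z = 0`, `t = 1`, `t' = 0`, `τ = ε/2`; `ofReal 1 * V₀ = V₀`, `ofReal 0 * V₀ = 0`), hence
  the crux.

So the infrared content of this crux (registered stub `stub_fidelityForEach` / `stub_fidelityPair`) and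
of stmt-14395 is one and the same open statement up to the box convention and the potential class.
-/

noncomputable section

namespace Summit.AtomisticToContinuum.BoseEinsteinCondensation.Cruxes.CloudMomentumAtom.Birth

open MeasureTheory Filter
open scoped ENNReal NNReal BigOperators ComplexConjugate
open Literature.MathematicalPhysics.QuantumManyBody.BoseGas

/-- Conjugate symmetry of the overlap modulus: `‖⟨Ψ, Φ⟩‖₊ = ‖⟨Φ, Ψ⟩‖₊` for the cell inner product
`⟨Ψ, Φ⟩ = ∫_{cell^N} conj Ψ · Φ`. [folklore] -/
theorem nnnorm_integral_conj_mul_comm {N : ℕ} {L : ℝ} (f g : Config N → ℂ) :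
    ‖∫ X in cellN N L, conj (f X) * g X‖₊ = ‖∫ X in cellN N L, conj (g X) * f X‖₊ := by
  have h : (∫ X in cellN N L, conj (g X) * f X) = conj (∫ X in cellN N L, conj (f X) * g X) := by
    rw [← integral_conj]
    refine integral_congr_ae (Filter.Eventually.of_forall fun X => ?_)
    simp [mul_comm]
  rw [h, RCLike.nnnorm_conj]

/-- **The crux from the "∀Φ ∀Ψ" endpoint fidelity.** If for every repulsive finite-range `v` and
`ε > 0` there is `ρ₀ > 0` such that for `0 < ρ < ρ₀`, eventually in `N`, at `L = sideLength ρ (N + 1)`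
with finite free and pinned infima there is a slack `δ > 0` such that EVERY pinned `δ`-near-minimiser
`Φ` (scatterer at the origin) and EVERY free `δ`-near-minimiser `Ψ` satisfy `1 − ε ≤ |⟨Ψ, Φ⟩|²`, then
`CloudMomentumAtom` holds. Proof: given the free slack `δ₂` asked by `cloudMomentumAtom_of_fidelityForEach`,
answer with the pinned slack `δ₁ := min δ δ₂` and, for each `Φ`, with any free `min δ δ₂`-near-minimiser
`Ψ` (one exists because `E^per < ⊤`). [folklore] -/
theorem cloudMomentumAtom_of_endpointFidelity :
    (∀ (v : ℝ → ℝ≥0∞), IsRepulsiveFiniteRange v → ∀ ε : ℝ, 0 < ε →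
      ∃ ρ₀ : ℝ, 0 < ρ₀ ∧ ∀ ρ : ℝ, 0 < ρ → ρ < ρ₀ → ∀ᶠ N : ℕ in atTop,
        ∀ L : ℝ, L = sideLength ρ (N + 1) →
          periodicGroundStateEnergy v N L ≠ ⊤ →
          impurityPeriodicGroundStateEnergy v N L 0 ≠ ⊤ →
          ∃ δ : ℝ≥0∞, 0 < δ ∧
            ∀ Φ Ψ : PeriodicTrialState N L,
              impurityPeriodicEnergy v 0 Φ ≤ impurityPeriodicGroundStateEnergy v N L 0 + δ →
              periodicEnergy v Ψ ≤ periodicGroundStateEnergy v N L + δ →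
              ENNReal.ofReal (1 - ε) ≤
                (‖∫ X in cellN N L, conj (Ψ.ψ X) * Φ.ψ X‖₊ : ℝ≥0∞) ^ 2) →
    Summit.AtomisticToContinuum.BoseEinsteinCondensation.Theses.BECProbeMassFlow.CloudMomentumAtom := by
  intro hE
  refine cloudMomentumAtom_of_fidelityForEach fun v hv ε hε => ?_
  obtain ⟨ρ₀, hρ₀, H⟩ := hE v hv ε hε
  refine ⟨ρ₀, hρ₀, fun ρ hρ hρlt => ?_⟩
  filter_upwards [H ρ hρ hρlt] with N hN
  intro L hL hEper hEimp δ₂ hδ₂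
  obtain ⟨δ, hδ, K⟩ := hN L hL hEper hEimp
  refine ⟨min δ δ₂, lt_min hδ hδ₂, fun Φ hΦ => ?_⟩
  -- a free `min δ δ₂`-near-minimiser
  have hlt : periodicGroundStateEnergy v N L < periodicGroundStateEnergy v N L + min δ δ₂ :=
    ENNReal.lt_add_right hEper (lt_min hδ hδ₂).ne'
  obtain ⟨Ψ, hΨ⟩ := iInf_lt_iff.1 hlt
  refine ⟨Ψ, hΨ.le.trans (add_le_add le_rfl (min_le_right _ _)), ?_⟩
  exact K Φ Ψ (hΦ.trans (add_le_add le_rfl (min_le_left _ _)))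
    (hΨ.le.trans (add_le_add le_rfl (min_le_left _ _)))

/-- **The crux from the static-impurity rigidity of `BECSwapNoCatastrophe` read at this route's box.**
Hypothesis: the body of `Theses.BECSwapNoCatastrophe.TorusStaticImpurityRigidity` (stmt-14395) with the
side `sideLength ρ N` replaced by `sideLength ρ (N + 1)` and the boundedness guard on `v` dropped — for
every repulsive finite-range `v` and `ε > 0` there is `ρ₀ > 0` such that for `0 < ρ < ρ₀`, eventually in
`N`, for every scatterer position `z`, all couplings `t, t' ∈ [0, 1]` and every `τ > 0` there is `δ > 0`
such that `δ`-near-minimisers `Φ` of `E_t = ⟨·, (H_N + t·V_z)·⟩` and `Φ'` of `E_{t'}` overlap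
`≥ 1 − ε (t − t')² − τ`. Conclusion: `CloudMomentumAtom`. Proof: `z = 0`, `t = 1`, `t' = 0`, `τ = ε/2`
with `ε/2` give the endpoint fidelity of `cloudMomentumAtom_of_endpointFidelity` (`E_1` is
`impurityPeriodicEnergy v 0`, `E_0` is `periodicEnergy v`, and the overlap modulus is conjugate-symmetric).
[folklore] -/
theorem cloudMomentumAtom_of_staticImpurityRigiditySucc :
    (∀ (v : ℝ → ℝ≥0∞), IsRepulsiveFiniteRange v → ∀ ε : ℝ, 0 < ε →
      ∃ ρ₀ : ℝ, 0 < ρ₀ ∧ ∀ ρ : ℝ, 0 < ρ → ρ < ρ₀ → ∀ᶠ N : ℕ in atTop,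
        let L : ℝ := sideLength ρ (N + 1)
        let Et : Space → ℝ → PeriodicTrialState N L → ℝ≥0∞ := fun z t Φ =>
          periodicEnergy v Φ +
            ENNReal.ofReal t * ∫⁻ X in cellN N L, impurityInteraction v L z X * (‖Φ.ψ X‖₊ : ℝ≥0∞) ^ 2
        ∀ z : Space, ∀ t : ℝ, 0 ≤ t → t ≤ 1 → ∀ t' : ℝ, 0 ≤ t' → t' ≤ 1 → ∀ τ : ℝ, 0 < τ →
          ∃ δ : ℝ≥0∞, 0 < δ ∧ ∀ Φ Φ' : PeriodicTrialState N L,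
            Et z t Φ ≤ (⨅ Φ'' : PeriodicTrialState N L, Et z t Φ'') + δ →
            Et z t' Φ' ≤ (⨅ Φ'' : PeriodicTrialState N L, Et z t' Φ'') + δ →
            ENNReal.ofReal (1 - ε * (t - t') ^ 2 - τ) ≤
              (‖∫ X in cellN N L, conj (Φ.ψ X) * Φ'.ψ X‖₊ : ℝ≥0∞) ^ 2) →
    Summit.AtomisticToContinuum.BoseEinsteinCondensation.Theses.BECProbeMassFlow.CloudMomentumAtom := by
  intro hR
  refine cloudMomentumAtom_of_endpointFidelity fun v hv ε hε => ?_
  obtain ⟨ρ₀, hρ₀, H⟩ := hR v hv (ε / 2) (half_pos hε)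
  refine ⟨ρ₀, hρ₀, fun ρ hρ hρlt => ?_⟩
  filter_upwards [H ρ hρ hρlt] with N hN
  intro L hL _ _
  subst hL
  obtain ⟨δ, hδ, K⟩ :=
    hN 0 1 zero_le_one le_rfl 0 le_rfl zero_le_one (ε / 2) (half_pos hε)
  refine ⟨δ, hδ, fun Φ Ψ hΦ hΨ => ?_⟩
  have key := K Φ Ψ ?_ ?_
  · -- `1 - ε/2 · (1 - 0)² - ε/2 = 1 - ε`, and the overlap modulus is conjugate-symmetric
    have hε' : 1 - ε / 2 * (1 - 0) ^ 2 - ε / 2 = 1 - ε := by ring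
    rw [hε'] at key
    rwa [nnnorm_integral_conj_mul_comm] at key
  · -- pinned: `E_1 = impurityPeriodicEnergy v 0`
    simpa only [ENNReal.ofReal_one, one_mul, impurityPeriodicEnergy_eq,
      impurityPeriodicGroundStateEnergy] using hΦ
  · -- free: `E_0 = periodicEnergy v`
    simpa only [ENNReal.ofReal_zero, zero_mul, add_zero, periodicGroundStateEnergy] using hΨ


/-- **Registered sub-goal (cross-route link, PROVED):** `cloudMomentumAtom_of_staticImpurityRigiditySucc`
with the `let`s of stmt-14395 inlined (`L := sideLength ρ (N + 1)`,
`E_t(Φ) := periodicEnergy v Φ + ofReal t · ∫ V_z |Φ|²`), so that the ledger records the implication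
"static-impurity rigidity at box `N + 1` ⇒ `CloudMomentumAtom`" by name. [folklore] -/
theorem stub_cloudMomentumAtom_of_staticImpurityRigiditySucc :
    (∀ (v : ℝ → ℝ≥0∞), IsRepulsiveFiniteRange v → ∀ ε : ℝ, 0 < ε → ∃ ρ₀ : ℝ, 0 < ρ₀ ∧ ∀ ρ : ℝ, 0 < ρ → ρ < ρ₀ → ∀ᶠ N : ℕ in atTop, ∀ z : Space, ∀ t : ℝ, 0 ≤ t → t ≤ 1 → ∀ t' : ℝ, 0 ≤ t' → t' ≤ 1 → ∀ τ : ℝ, 0 < τ → ∃ δ : ℝ≥0∞, 0 < δ ∧ ∀ Φ Φ' : PeriodicTrialState N (sideLength ρ (N + 1)), periodicEnergy v Φ + ENNReal.ofReal t * ∫⁻ X in cellN N (sideLength ρ (N + 1)), impurityInteraction v (sideLength ρ (N + 1)) z X * (‖Φ.ψ X‖₊ : ℝ≥0∞) ^ 2 ≤ (⨅ Φ'' : PeriodicTrialState N (sideLength ρ (N + 1)), periodicEnergy v Φ'' + ENNReal.ofReal t * ∫⁻ X in cellN N (sideLength ρ (N + 1)), impurityInteraction v (sideLength ρ (N + 1))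 z X * (‖Φ''.ψ X‖₊ : ℝ≥0∞) ^ 2) + δ → periodicEnergy v Φ' + ENNReal.ofReal t' * ∫⁻ X in cellN N (sideLength ρ (N + 1)), impurityInteraction v (sideLength ρ (N + 1)) z X * (‖Φ'.ψ X‖₊ : ℝ≥0∞) ^ 2 ≤ (⨅ Φ'' : PeriodicTrialState N (sideLength ρ (N + 1)), periodicEnergy v Φ'' + ENNReal.ofReal t' * ∫⁻ X in cellN N (sideLength ρ (N + 1)), impurityInteraction v (sideLength ρ (N + 1)) z X * (‖Φ''.ψ X‖₊ : ℝ≥0∞) ^ 2) + δ → ENNReal.ofReal (1 - ε * (t - t') ^ 2 - τ) ≤ (‖∫ X in cellN N (sideLength ρ (N + 1)), conj (Φ.ψ X) * Φ'.ψ X‖₊ : ℝ≥0∞) ^ 2) → Summit.AtomisticToContinuum.BoseEinsteinCondensation.Theses.BECProbeMassFlow.CloudMomentumAtom :=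
  cloudMomentumAtom_of_staticImpurityRigiditySucc

end Summit.AtomisticToContinuum.BoseEinsteinCondensation.Cruxes.CloudMomentumAtom.Birth

end
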